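import Summits.KontsevichZagierPeriods.Zeta5Search.WellPoisedFaceLinearForms
import Summits.KontsevichZagierPeriods.Zeta5Search.LaiDenominators
import Summits.KontsevichZagierPeriods.Zeta5Search.DualSeriesLemma19Order
import HarnessLib

/-!
# Well-poised face forms — Lemma 19's SHARP WINDOWS: `D_{M₁}³D_{M₂}D_{M₃}D_{M₄}·F(h_n) ∈ ℤζ(5) + ℤ`

pub-zeta5 · fam-vwp generation 7, file 7.  HONEST FRAMING: systematic search; no irrationality claim unless
certified.  Nothing here is evidence about `ζ(5)`.

`WellPoisedFaceLinearForms` proved the MEANING of the face theorem with the crude frame denominator: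
`D_{η₀n}⁶·F(h_n) ∈ ℤζ(5) + ℤ`.  [Zudilin2004, Lemma 19] has the sharp denominator
`D_{M₁}³D_{M₂}D_{M₃}D_{M₄}·Φ⁻¹`, `M_j = n·max(η₀ − 2η_(1), η₀ − η_(j))` for the SORTED direction
`η_(1) ≤ η_(2) ≤ η_(3) ≤ η_(4) < η₀/2`.  This file proves the WINDOW part of that refinement in the kernel:

* `facePi_mul_faceF_mem` — `D_{M₁}³D_{M₂}D_{M₃}D_{M₄} · F(h_n) ∈ ℤ·ζ(5) + ℤ` for every sorted integral face
  direction and every `n`;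
* `facePhi_mul_faceLambda_mem` — equivalently `Φ(h_n) · Λ_n ∈ ℤ·ζ(5) + ℤ` for the normalised forms `Λ_n` of
  `WellPoisedFaceGrowth` (`faceLambda`).

What remains PRINTED of Lemma 19 is exactly the `Φ⁻¹` saving (the `p`-adic estimates (8.11) of
[Zudilin2004, Lemmas 17–18]); it is not formalised here.

## Method
The face function `R(t−1)` IS Lai's box function at `r = 0`: `faceRQ η₀ η n t = C_n · laiCore 4 0 η₀ n η (t+1)`
(`faceRQ_eq_laiCore`).  Hence the partial-fraction data of fam-indep's port of [Zudilin2004, Lemmas 15–16]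
(`lai_pf_exists`, `lai_pf_isInt`, `lai_pf_mem_block`) serve as face data: `D_{(η₀−2η_(1))n}^{3−o}·ĉ_{o,p} ∈ ℤ`
((8.10) with `m₀ = h₀ − 2h_1`) and `ĉ_{o,p} ≠ 0 ⇒ η_o n ≤ p ≤ (η₀ − η_o)n` (the pole of order `o+1` lives in
the window of brick `o`).  `WellPoisedFaceLinearForms.faceF_eq_coef` then gives `F = A·ζ(5) − B` with
`A = 6Σ_p ĉ_{2,p}`, `B = Σ_{o,p} binom(o+2,2) ĉ_{o,p} H_p^{(o+3)}`, and the bookkeeping of [Zudilin2004, p. 19]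
(`D_{M₁}…D_{M_{o+3}}·H_p^{(o+3)} ∈ ℤ` for `p ≤ (η₀−η_o)n ≤ M_i`, `D_{m₀}^{3−o} ∣ D_{M_{o+4}}⋯D_{M₆}`) is
`term_isInt`.
-/

noncomputable section

open Finset Filter Polynomial

namespace Summit.KontsevichZagierPeriods.Zeta5Search.WellPoisedFaceRate

open Literature.NumberTheory.Transcendental (zetaValue lcmUpto_dvd_lcmUpto)
open Literature.NumberTheory.Transcendental.BallRivoal (pfEval IsInt poch harm)
open DualSeriesLemma19 (isInt_prod_mul_harm)

variable (η₀ : ℕ) (η : Fin 4 → ℕ) (n : ℕ)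

/-! ## 1. Sorted directions -/

/-- A sorted direction is monotone. -/
theorem eta_mono (h01 : η 0 ≤ η 1) (h12 : η 1 ≤ η 2) (h23 : η 2 ≤ η 3) : Monotone η := by
  refine Fin.monotone_iff_le_succ.2 fun i => ?_
  fin_cases i
  exacts [h01, h12, h23]

/-- `etaN` at an index `< 4`. -/
theorem etaN_of_lt (s : ℕ) (hs : s < 4) : etaN η s = η ⟨s, hs⟩ := by
  unfold etaN; rw [dif_pos hs]

/-- `etaN` is monotone on `{0,1,2,3}` for a sorted direction. -/
theorem etaN_mono (h01 : η 0 ≤ η 1) (h12 : η 1 ≤ η 2) (h23 : η 2 ≤ η 3) {a b : ℕ} (hab : a ≤ b)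
    (hb : b < 4) : etaN η a ≤ etaN η b := by
  rw [etaN_of_lt η a (lt_of_le_of_lt hab hb), etaN_of_lt η b hb]
  exact eta_mono η h01 h12 h23 (Fin.mk_le_mk.2 hab)

/-! ## 2. The face function is Lai's box function at `r = 0` -/

/-- Length bookkeeping: `(η₀n + 2) − 2(η_j n + 1) = (η₀ − 2η_j)·n`. -/
theorem len_eq (hη : ∀ j, 2 * η j < η₀) (j : Fin 4) :
    (η₀ * n + 2) - 2 * (η j * n + 1) = (η₀ - 2 * η j) * n := by
  have h2 : 2 * (η j * n) ≤ η₀ * n := by rw [← mul_assoc]; exact Nat.mul_le_mul_right n (hη j).le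
  have e : (η₀ - 2 * η j) * n = η₀ * n - 2 * (η j * n) := by rw [Nat.sub_mul, mul_assoc]
  omega

/-- **`R(t−1) = C_n · (Lai core at r = 0)(t+1)`**: the face function of `WellPoisedFaceLinearFormsPF`
(`faceRQ`, poles at `t = −p−1`) is Lai's unit-block function with `J = 4`, `r = 0`, `M = η₀`, `δ = η`. -/
theorem faceRQ_eq_laiCore (hη : ∀ j, 2 * η j < η₀) (t : ℚ) :
    faceRQ η₀ η n t = laiC 4 0 η₀ n η * laiCore 4 0 η₀ n η (t + 1) := by
  have hB : ∀ j : Fin 4,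
      (∏ i ∈ range ((η₀ * n + 2) - 2 * (η j * n + 1) + 1), (t + ((η j * n + 1 : ℕ) : ℚ) + (i : ℚ)))
        = ∏ i ∈ range ((η₀ - 2 * η j) * n + 1), (t + 1 + (η j : ℚ) * n + (i : ℚ)) := by
    intro j
    rw [len_eq η₀ η n hη j]
    refine prod_congr rfl fun i _ => ?_
    push_cast; ring
  have hF : ∀ j : Fin 4, ((((η₀ * n + 2) - 2 * (η j * n + 1)).factorial : ℕ) : ℚ)
      = ((((η₀ - 2 * η j) * n).factorial : ℕ) : ℚ) := by
    intro j; rw [len_eq η₀ η n hη j]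
  simp only [faceRQ, laiC, laiCore, laiNum, laiDen, laiBlock, hB, hF, mul_zero, zero_mul, pow_zero, div_one,
    prod_range_zero, mul_one, prod_div_distrib]
  push_cast
  ring

/-! ## 3. Lai data for the face -/

/-- The set of Lai-form partial-fraction data of the face on the frame `(t+1)_{η₀n+1}` (the normal form
of `LaiBrickCoefficients`: `J = 4`, `r = 0`, `M = η₀`, `δ = η`). -/
def laiFaceData : Set (ℕ → ℕ → ℚ) :=
  {c | ∀ t : ℚ, (∀ p : ℕ, p ≤ η₀ * n → t + p + 1 ≠ 0) →
    pfEval (η₀ * n) 4 c t = ((laiPoly 4 0 η₀ n η).comp (X + C 1)).eval t / poch (t + 1) (η₀ * n + 1) ^ 4}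

/-- Lai data exist (`lai_pf_exists`; the degree condition is `Σ_j 2η_j n + 3 ≤ 4(η₀ n + 1)`). -/
theorem exists_laiFaceData (hη : ∀ j, 2 * η j < η₀) : ∃ c, c ∈ laiFaceData η₀ η n := by
  have h : ∀ j, 2 * (η j * n) ≤ η₀ * n := fun j => by
    rw [← mul_assoc]; exact Nat.mul_le_mul_right n (hη j).le
  have hs : ∑ j, 2 * (η j * n) ≤ ∑ _j : Fin 4, η₀ * n := sum_le_sum fun j _ => h j
  rw [sum_const, card_univ, Fintype.card_fin, smul_eq_mul] at hs
  obtain ⟨c, hc⟩ := lai_pf_exists 4 0 η₀ n η (by norm_num) (by omega)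
  exact ⟨c, hc⟩

/-- The face data: `ĉ_{o,p} = C_n · c_{o,p}` on `o < 4`, `p ≤ η₀ n`, zero elsewhere. -/
def faceDataOf (c : ℕ → ℕ → ℚ) : ℕ → ℕ → ℚ := fun o p =>
  if o < 4 ∧ p ≤ η₀ * n then laiC 4 0 η₀ n η * c o p else 0

/-- `pfEval` of the face data is `C_n · pfEval` of the Lai data. -/
theorem pfEval_faceDataOf (c : ℕ → ℕ → ℚ) (t : ℚ) :
    pfEval (η₀ * n) 4 (faceDataOf η₀ η n c) t = laiC 4 0 η₀ n η * pfEval (η₀ * n) 4 c t := by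
  unfold pfEval faceDataOf
  rw [mul_sum]
  refine sum_congr rfl fun p hp => ?_
  rw [mul_sum]
  refine sum_congr rfl fun o ho => ?_
  rw [if_pos ⟨mem_range.1 ho, Nat.lt_succ_iff.1 (mem_range.1 hp)⟩]
  ring

/-- **The face data are partial-fraction data of `R(t−1)` on the frame `(t+1)_{η₀n+1}`** (the hypothesis
`hc` of `WellPoisedFaceLinearForms`, with `C = 0`). -/
theorem faceRQ_eq_pfEval (hη : ∀ j, 2 * η j < η₀) {c : ℕ → ℕ → ℚ} (hc : c ∈ laiFaceData η₀ η n) (t : ℚ)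
    (ht : ∀ p : ℕ, p ≤ η₀ * n → t + p + 1 ≠ 0) :
    faceRQ η₀ η n t = pfEval (η₀ * n) 4 (faceDataOf η₀ η n c) t + (0 : ℚ) := by
  have hδ : ∀ j, 2 * η j ≤ η₀ := fun j => (hη j).le
  have hu : ∀ p : ℕ, p ≤ η₀ * n → t + 1 + p ≠ 0 := fun p hp h => ht p hp (by linarith)
  rw [add_zero, pfEval_faceDataOf, faceRQ_eq_laiCore η₀ η n hη t, laiCore_eq_pfEval 4 0 η₀ n η hδ hc hu,
    add_sub_cancel_right]

/-! ## 4. Integrality and windows of the face data ([Zudilin2004, (8.10)] and Lemma 16) -/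

/-- **(8.10) on the face: `D_{(η₀−2η_(1))n}^{3−o} · ĉ_{o,p} ∈ ℤ`** (`lai_pf_isInt` inside the big window,
`lai_pf_eq_zero_of_lt` outside it). -/
theorem faceData_isInt (h01 : η 0 ≤ η 1) (h12 : η 1 ≤ η 2) (h23 : η 2 ≤ η 3) (h3 : 2 * η 3 < η₀)
    {c : ℕ → ℕ → ℚ} (hc : c ∈ laiFaceData η₀ η n) :
    IsInt 4 (Nat.lcmUpto ((η₀ - 2 * etaN η 0) * n)) (faceDataOf η₀ η n c) := by
  have hη := two_mul_lt_of_sorted η₀ η h01 h12 h23 h3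
  have hδ : ∀ j, 2 * η j ≤ η₀ := fun j => (hη j).le
  have hM : 0 < η₀ := by have := hη 0; omega
  have e0 : etaN η 0 = η ⟨0, by norm_num⟩ := etaN_of_lt η 0 (by norm_num)
  have hmin : ∀ j, etaN η 0 ≤ η j := fun j => by
    rw [e0]; exact eta_mono η h01 h12 h23 (Fin.zero_le j)
  have h2 : 2 * etaN η 0 < η₀ := by rw [e0]; exact hη _
  intro o p
  by_cases hop : o < 4 ∧ p ≤ η₀ * n
  · simp only [faceDataOf, if_pos hop]
    by_cases hwin : etaN η 0 * n ≤ p ∧ p ≤ (η₀ - etaN η 0) * n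
    · obtain ⟨z, hz⟩ := lai_pf_isInt 4 0 η₀ n η hδ hc (etaN η 0) hmin h2 hwin.1 hwin.2
        (s := o + 1) (by omega) (by omega)
      have e1 : 4 - (o + 1) = 4 - 1 - o := by omega
      rw [e1, Nat.add_sub_cancel] at hz
      exact ⟨z, hz⟩
    · have hk : ∀ j, p < η j * n ∨ (η₀ - η j) * n < p := by
        intro j
        rcases not_and_or.1 hwin with h | h
        · exact Or.inl (lt_of_lt_of_le (not_le.1 h) (Nat.mul_le_mul_right n (hmin j)))
        · exact Or.inr (lt_of_le_of_lt (Nat.mul_le_mul_right n (Nat.sub_le_sub_left (hmin j) η₀)) (not_le.1 h))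
      have hz : c o p = 0 := lai_pf_eq_zero_of_lt 4 0 η₀ n η hδ hM hc hk hop.2 hop.1
      exact ⟨0, by rw [hz]; simp⟩
  · exact ⟨0, by simp only [faceDataOf, if_neg hop]; simp⟩

/-- **Windows (Lemma 16 on the face): `ĉ_{o,p} ≠ 0 ⇒ η_o n ≤ p ≤ (η₀ − η_o)n`** — the pole of order `o+1`
at `t = −p−1` comes from at least `o+1` bricks, hence from brick `o` or a later (wider-offset) one, all of whose
windows lie inside brick `o`'s window for a sorted direction (`lai_pf_mem_block`). -/
theorem faceData_window (h01 : η 0 ≤ η 1) (h12 : η 1 ≤ η 2) (h23 : η 2 ≤ η 3) (h3 : 2 * η 3 < η₀)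
    {c : ℕ → ℕ → ℚ} (hc : c ∈ laiFaceData η₀ η n) {o p : ℕ} (ho : o < 4)
    (hne : faceDataOf η₀ η n c o p ≠ 0) : etaN η o * n ≤ p ∧ p ≤ (η₀ - etaN η o) * n := by
  have hη := two_mul_lt_of_sorted η₀ η h01 h12 h23 h3
  have hδ : ∀ j, 2 * η j ≤ η₀ := fun j => (hη j).le
  have hM : 0 < η₀ := by have := hη 0; omega
  by_cases hop : o < 4 ∧ p ≤ η₀ * n
  · simp only [faceDataOf, if_pos hop] at hne
    have hne' : c o p ≠ 0 := fun h => hne (by rw [h, mul_zero])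
    rw [etaN_of_lt η o ho]
    exact lai_pf_mem_block 4 0 η₀ n η hδ hM (eta_mono η h01 h12 h23) hc hop.2 ho hne'
  · exact absurd (by simp only [faceDataOf, if_neg hop]) hne

/-! ## 5. The sharp denominator `Π = D_{M₁}³ D_{M₂} D_{M₃} D_{M₄}` -/

/-- The six factors `D_{M₁}, D_{M₁}, D_{M₁}, D_{M₂}, D_{M₃}, D_{M₄}` (`i ↦` slot `i − 2`, truncated):
`dFac i = D_{n · max(η₀ − 2η_(1), η₀ − η_(i−2))}`. -/
def dFac (i : ℕ) : ℕ := Nat.lcmUpto (n * max (η₀ - 2 * etaN η 0) (η₀ - etaN η (i - 2)))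

/-- `Π := ∏_{i<6} dFac i = D_{M₁}³ D_{M₂} D_{M₃} D_{M₄}`. -/
def facePi : ℕ := ∏ i ∈ range 6, dFac η₀ η n i

/-- The first `o + 3` factors are multiples of `D_{(η₀ − η_o)n}` (slot `i − 2 ≤ o`, sorted direction). -/
theorem dFac_dvd_window (h01 : η 0 ≤ η 1) (h12 : η 1 ≤ η 2) (h23 : η 2 ≤ η 3) {o : ℕ} (ho : o < 4)
    {i : ℕ} (hi : i < o + 3) : Nat.lcmUpto ((η₀ - etaN η o) * n) ∣ dFac η₀ η n i :=
  lcmUpto_dvd_lcmUpto (by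
    rw [mul_comm]
    exact Nat.mul_le_mul_left n
      ((Nat.sub_le_sub_left (etaN_mono η h01 h12 h23 (by omega) ho) η₀).trans (le_max_right _ _)))

/-- Every factor is a multiple of `D_{m₀}`, `m₀ = (η₀ − 2η_(1))·n`. -/
theorem dFac_dvd_base (i : ℕ) : Nat.lcmUpto ((η₀ - 2 * etaN η 0) * n) ∣ dFac η₀ η n i :=
  lcmUpto_dvd_lcmUpto (by rw [mul_comm]; exact Nat.mul_le_mul_left n (le_max_left _ _))

/-- `Π` is the product `D_{M₁}³D_{M₂}D_{M₃}D_{M₄}` of `faceLambda` (`M_j = n · faceM j`). -/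
theorem facePi_eq : facePi η₀ η n = Nat.lcmUpto (n * faceM η₀ η 0) ^ 3 * Nat.lcmUpto (n * faceM η₀ η 1)
    * Nat.lcmUpto (n * faceM η₀ η 2) * Nat.lcmUpto (n * faceM η₀ η 3) := by
  have e0 : etaN η 0 = η 0 := by simpa using etaN_fin η 0
  have e1 : etaN η 1 = η 1 := by simpa using etaN_fin η 1
  have e2 : etaN η 2 = η 2 := by simpa using etaN_fin η 2
  have e3 : etaN η 3 = η 3 := by simpa using etaN_fin η 3
  simp only [facePi, dFac, prod_range_succ, prod_range_zero, one_mul, Nat.reduceSub, e0, e1, e2, e3, faceM]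
  ring

/-! ## 6. Term-by-term integrality ([Zudilin2004, p. 19, the `fairly rough' inclusions]) -/

/-- **`Π · ĉ_{o,p} · H_p^{(o+3)} ∈ ℤ`**: split `Π = (∏_{i<o+3} dFac i) · (∏_{o+3≤i<6} dFac i)`; the first
factor clears `H_p^{(o+3)}` (`p ≤ (η₀−η_o)n` by the window, `isInt_prod_mul_harm`), the second is a multiple of
`D_{m₀}^{3−o}`, which clears `ĉ_{o,p}` by (8.10). -/
theorem term_isInt (h01 : η 0 ≤ η 1) (h12 : η 1 ≤ η 2) (h23 : η 2 ≤ η 3) (h3 : 2 * η 3 < η₀)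
    {c : ℕ → ℕ → ℚ} (hc : c ∈ laiFaceData η₀ η n) {o : ℕ} (ho : o < 4) (p : ℕ) :
    ∃ z : ℤ, ((facePi η₀ η n : ℕ) : ℚ) * (faceDataOf η₀ η n c o p * harm (o + 3) p) = z := by
  by_cases hz : faceDataOf η₀ η n c o p = 0
  · exact ⟨0, by rw [hz]; simp⟩
  obtain ⟨-, hhi⟩ := faceData_window η₀ η n h01 h12 h23 h3 hc ho hz
  have hsplit : ((facePi η₀ η n : ℕ) : ℚ)
      = (∏ i ∈ range (o + 3), (dFac η₀ η n i : ℚ)) * ∏ i ∈ Ico (o + 3) 6, (dFac η₀ η n i : ℚ) := by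
    rw [facePi, Nat.cast_prod, prod_range_mul_prod_Ico _ (show o + 3 ≤ 6 by omega)]
  obtain ⟨z₁, hz₁⟩ := isInt_prod_mul_harm (range (o + 3)) (dFac η₀ η n) p (fun i hi l hl1 hlp =>
    (DualSeriesDenominators.natCast_dvd_lcmUpto hl1 (hlp.trans hhi)).trans
      (Int.natCast_dvd_natCast.2 (dFac_dvd_window η₀ η n h01 h12 h23 ho (mem_range.1 hi))))
  rw [card_range] at hz₁
  have hdvd : Nat.lcmUpto ((η₀ - 2 * etaN η 0) * n) ^ (3 - o) ∣ ∏ i ∈ Ico (o + 3) 6, dFac η₀ η n i := by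
    have e : (∏ _i ∈ Ico (o + 3) 6, Nat.lcmUpto ((η₀ - 2 * etaN η 0) * n))
        = Nat.lcmUpto ((η₀ - 2 * etaN η 0) * n) ^ (3 - o) := by
      rw [prod_const, Nat.card_Ico, show 6 - (o + 3) = 3 - o by omega]
    rw [← e]
    exact prod_dvd_prod_of_dvd _ _ fun i _ => dFac_dvd_base η₀ η n i
  obtain ⟨Q, hQ⟩ := hdvd
  obtain ⟨z₂, hz₂⟩ := faceData_isInt η₀ η n h01 h12 h23 h3 hc o p
  rw [show 4 - 1 - o = 3 - o by omega] at hz₂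
  have hQ' : (∏ i ∈ Ico (o + 3) 6, (dFac η₀ η n i : ℚ))
      = ((Nat.lcmUpto ((η₀ - 2 * etaN η 0) * n) : ℕ) : ℚ) ^ (3 - o) * (Q : ℚ) := by
    rw [← Nat.cast_prod, hQ]; push_cast; ring
  refine ⟨z₁ * (Q * z₂), ?_⟩
  rw [hsplit, hQ']
  push_cast
  rw [← hz₁, ← hz₂]
  ring

/-- `Π · B ∈ ℤ`. -/
theorem facePi_mul_coefB (h01 : η 0 ≤ η 1) (h12 : η 1 ≤ η 2) (h23 : η 2 ≤ η 3) (h3 : 2 * η 3 < η₀)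
    {c : ℕ → ℕ → ℚ} (hc : c ∈ laiFaceData η₀ η n) :
    ∃ z : ℤ, ((facePi η₀ η n : ℕ) : ℚ) * coefB (η₀ * n) (faceDataOf η₀ η n c) = z := by
  have h : ∀ p ∈ range (η₀ * n + 1), ∃ z : ℤ, ((facePi η₀ η n : ℕ) : ℚ) *
      (faceDataOf η₀ η n c 0 p * harm 3 p + 3 * (faceDataOf η₀ η n c 1 p * harm 4 p)
        + 6 * (faceDataOf η₀ η n c 2 p * harm 5 p) + 10 * (faceDataOf η₀ η n c 3 p * harm 6 p)) = z := by
    intro p _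
    obtain ⟨z0, h0⟩ := term_isInt η₀ η n h01 h12 h23 h3 hc (o := 0) (by norm_num) p
    obtain ⟨z1, h1⟩ := term_isInt η₀ η n h01 h12 h23 h3 hc (o := 1) (by norm_num) p
    obtain ⟨z2, h2⟩ := term_isInt η₀ η n h01 h12 h23 h3 hc (o := 2) (by norm_num) p
    obtain ⟨z3, h3'⟩ := term_isInt η₀ η n h01 h12 h23 h3 hc (o := 3) (by norm_num) p
    norm_num only [Nat.reduceAdd] at h0 h1 h2 h3'
    refine ⟨z0 + 3 * z1 + 6 * z2 + 10 * z3, ?_⟩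
    push_cast
    rw [← h0, ← h1, ← h2, ← h3']
    ring
  obtain ⟨z, hz⟩ := exists_int_sum _ _ h
  exact ⟨z, by rw [← hz, coefB, mul_sum]⟩

/-- `Π · A ∈ ℤ` (indeed `D_{m₀} · A ∈ ℤ` and `D_{m₀} ∣ D_{M₁} ∣ Π`). -/
theorem facePi_mul_coefA (h01 : η 0 ≤ η 1) (h12 : η 1 ≤ η 2) (h23 : η 2 ≤ η 3) (h3 : 2 * η 3 < η₀)
    {c : ℕ → ℕ → ℚ} (hc : c ∈ laiFaceData η₀ η n) :
    ∃ z : ℤ, ((facePi η₀ η n : ℕ) : ℚ) * coefA (η₀ * n) (faceDataOf η₀ η n c) = z := by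
  obtain ⟨z, hz⟩ := coefA_den (η₀ * n) (Nat.lcmUpto ((η₀ - 2 * etaN η 0) * n)) _
    (faceData_isInt η₀ η n h01 h12 h23 h3 hc)
  have hdvd : Nat.lcmUpto ((η₀ - 2 * etaN η 0) * n) ∣ facePi η₀ η n :=
    (dFac_dvd_base η₀ η n 0).trans (dvd_prod_of_mem _ (by simp))
  obtain ⟨Q, hQ⟩ := hdvd
  refine ⟨Q * z, ?_⟩
  rw [hQ, Nat.cast_mul, mul_comm ((Nat.lcmUpto _ : ℕ) : ℚ), mul_assoc, hz]
  push_cast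
  ring

/-! ## 7. The theorems -/

/-- **THEOREM (Lemma 19's sharp windows on the face, kernel).**  For every SORTED integral face direction
`η₀; 0³, η_0 ≤ η_1 ≤ η_2 ≤ η_3 < η₀/2` and every `n`:
`D_{M₁}³ D_{M₂} D_{M₃} D_{M₄} · F(h_n) ∈ ℤ·ζ(5) + ℤ`, `M_j = n · max(η₀ − 2η_0, η₀ − η_{j−1})`
([Zudilin2004, Lemma 19] without the `Φ⁻¹`; the `Φ⁻¹` saving stays printed). -/
theorem facePi_mul_faceF_mem (h01 : η 0 ≤ η 1) (h12 : η 1 ≤ η 2) (h23 : η 2 ≤ η 3) (h3 : 2 * η 3 < η₀) :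
    ∃ a b : ℤ, ((facePi η₀ η n : ℕ) : ℝ) * faceF η₀ η n = (a : ℝ) * zetaValue 5 - (b : ℝ) := by
  have hη := two_mul_lt_of_sorted η₀ η h01 h12 h23 h3
  obtain ⟨c, hc⟩ := exists_laiFaceData η₀ η n hη
  have hF := faceF_eq_coef hη (faceRQ_eq_pfEval η₀ η n hη hc)
  obtain ⟨a, ha⟩ := facePi_mul_coefA η₀ η n h01 h12 h23 h3 hc
  obtain ⟨b, hb⟩ := facePi_mul_coefB η₀ η n h01 h12 h23 h3 hc
  refine ⟨a, b, ?_⟩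
  have ea : ((facePi η₀ η n : ℕ) : ℝ) * (coefA (η₀ * n) (faceDataOf η₀ η n c) : ℝ) = (a : ℝ) := by
    have := congrArg (fun q : ℚ => (q : ℝ)) ha
    push_cast at this
    exact this
  have eb : ((facePi η₀ η n : ℕ) : ℝ) * (coefB (η₀ * n) (faceDataOf η₀ η n c) : ℝ) = (b : ℝ) := by
    have := congrArg (fun q : ℚ => (q : ℝ)) hb
    push_cast at this
    exact this
  rw [hF, mul_sub, ← mul_assoc, ea, eb]

/-- `Λ_n = Π / Φ · F` (dictionary with `WellPoisedFaceGrowth.faceLambda`). -/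
theorem faceLambda_eq (hη : ∀ j, 2 * η j < η₀) :
    faceLambda η₀ η n = ((facePi η₀ η n : ℕ) : ℝ) / (facePhi η₀ η n : ℝ) * faceF η₀ η n := by
  rw [faceLambda, faceMZ_toNat η₀ η hη n 0, faceMZ_toNat η₀ η hη n 1, faceMZ_toNat η₀ η hη n 2,
    faceMZ_toNat η₀ η hη n 3, facePi_eq]
  push_cast
  ring

/-- **COROLLARY.** `Φ(h_n) · Λ_n ∈ ℤ·ζ(5) + ℤ` for the normalised face forms `Λ_n` of `WellPoisedFaceGrowth`
(which tend to `+∞`, `faceLambda_tendsto_atTop`).  [Zudilin2004, Lemma 19] removes the factor `Φ(h_n)`; that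
`p`-adic saving is PRINTED, not formalised.  Either way nothing follows about `ζ(5)`. -/
theorem facePhi_mul_faceLambda_mem (h01 : η 0 ≤ η 1) (h12 : η 1 ≤ η 2) (h23 : η 2 ≤ η 3)
    (h3 : 2 * η 3 < η₀) :
    ∃ a b : ℤ, (facePhi η₀ η n : ℝ) * faceLambda η₀ η n = (a : ℝ) * zetaValue 5 - (b : ℝ) := by
  obtain ⟨a, b, h⟩ := facePi_mul_faceF_mem η₀ η n h01 h12 h23 h3
  refine ⟨a, b, ?_⟩
  have hΦ : (facePhi η₀ η n : ℝ) ≠ 0 := by exact_mod_cast (facePhi_pos η₀ η n).ne'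
  rw [faceLambda_eq η₀ η n (two_mul_lt_of_sorted η₀ η h01 h12 h23 h3), ← h]
  field_simp

/-- Kernel instance: the classical symmetric `ζ(5)` series, direction `(3; 0³, 1⁴)`: `M_j = n`, so
`D_n⁶ · F_n ∈ ℤζ(5) + ℤ` — versus the frame bound `D_{3n}⁶` of `WellPoisedFaceLinearForms`. -/
example (n : ℕ) : ∃ a b : ℤ,
    ((facePi 3 ![1, 1, 1, 1] n : ℕ) : ℝ) * faceF 3 ![1, 1, 1, 1] n = (a : ℝ) * zetaValue 5 - (b : ℝ) :=
  facePi_mul_faceF_mem 3 ![1, 1, 1, 1] n (by decide) (by decide) (by decide) (by decide)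

/-- Kernel instance: the MODEL face maximiser shape `(14; 0³, 4,4,5,5)` of FAMILY.md §13:
`D_{10n}³ D_{10n} D_{9n} D_{9n} · F_n ∈ ℤζ(5) + ℤ` (frame bound: `D_{14n}⁶`). -/
example (n : ℕ) : ∃ a b : ℤ,
    ((facePi 14 ![4, 4, 5, 5] n : ℕ) : ℝ) * faceF 14 ![4, 4, 5, 5] n = (a : ℝ) * zetaValue 5 - (b : ℝ) :=
  facePi_mul_faceF_mem 14 ![4, 4, 5, 5] n (by decide) (by decide) (by decide) (by decide)

end Summit.KontsevichZagierPeriods.Zeta5Search.WellPoisedFaceRate
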